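import Literature.Topology.FourManifolds.CollarCriterion

/-!
# A chart criterion for smooth embeddings `N × [0, 1] → ℝⁿ⁺²` (collars and strong isotopies
# realised in Euclidean space)

Topic `Literature/Topology/FourManifolds` (infrastructure for the fact seat
`provefact-Literature.Geometry.Riemannian.LawsonMichelsohn1984_surrounding`: the conclusion of
Lawson–Michelsohn's Thm. 6.1 is a *strong isotopy* — a smooth embedding
`Φ : N × [0, 1] → ℝ^{m+1}` for the product model with corners `(𝓡 m).prod (𝓡∂ 1)` in Mathlib's
chart-wise sense `Manifold.IsSmoothEmbedding` — obtained by flowing the hypersurface `e(N)`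
along a vector field of `ℝ^{m+1}`; this file isolates the chart bookkeeping turning such flow
data into the embedding property, in the manner of the tree's `CollarCriterion.lean` for
collars of a boundary).  Everything here is **proved**.

* `EuclideanCollarData n N` — the data `(toFun, proj, height, bot, top, region)`: a map
  `toFun : N → ℝ → ℝⁿ⁺²`, smooth on `N × (bot, top)` with `bot < 0`, `1 < top`, taking values in
  an open `region` on which it is inverted by the smooth maps `(proj, height)` (think: the flow
  lines of a field transverse to the hypersurface `toFun(·, 0)(N)`, `height` the function
  increasing at unit speed along them, `proj` the projection back to the hypersurface).
* `EuclideanCollarData.isSmoothEmbedding_collarMap` — **the closed collar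
  `(x, t) ↦ toFun x t` on `N × [0, 1]` is a smooth embedding** `(𝓡 (n + 1)).prod (𝓡∂ 1) → 𝓡 (n + 2)`.
  Charts: at points with `t < 1` the chart `z ↦ (height z, φ₀ (proj z))` of `ℝⁿ⁺²` and the
  product chart `φ₀ × (t ↦ t)` of `N × [0, 1)`, in which the collar reads `(w, s) ↦ (s, w)`; at
  points with `t > 0` the chart `z ↦ (1 - height z, φ₀ (proj z))` and `φ₀ × (t ↦ 1 - t)`, in which
  it reads `(w, s) ↦ (s, w)` again — linear in both cases (no tilt is needed, the charts of
  `ℝⁿ⁺²` being unconstrained, unlike the half-space-valued charts of `CollarCriterion.lean`).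

## References

* J. M. Lee, *Introduction to Smooth Manifolds*, 2nd ed. (2013), Thm. 9.20 (flowout theorem),
  Ch. 5 (embeddings). [LeeSmoothManifolds2013]
* M. W. Hirsch, *Differential Topology* (1976), §4.6 (collars). [Hirsch1976]
-/

noncomputable section

open Set Function
open scoped Manifold Topology ContDiff

namespace Literature.Topology.FourManifolds

universe u

variable {n : ℕ} {N : Type u} [TopologicalSpace N] [ChartedSpace (EuclideanSpace ℝ (Fin (n + 1))) N]

/-- **Euclidean collar data**: a map `toFun : N → ℝ → ℝⁿ⁺²`, meaningful on `N × (bot, top)`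
with `bot < 0 < 1 < top`, smooth there, valued in an open `region` of `ℝⁿ⁺²` on which it is
inverted by smooth maps `(proj, height)`.  (The Euclidean-target analogue of
`BoundaryData.OpenCollarData`, `CollarCriterion.lean`.) [folklore] -/
structure EuclideanCollarData (n : ℕ) (N : Type u) [TopologicalSpace N]
    [ChartedSpace (EuclideanSpace ℝ (Fin (n + 1))) N] where
  /-- The collar map `N × ℝ → ℝⁿ⁺²` (only its values on `N × (bot, top)` matter). -/
  toFun : N → ℝ → EuclideanSpace ℝ (Fin (n + 2))
  /-- The `N`-component of the inverse. -/
  proj : EuclideanSpace ℝ (Fin (n + 2)) → N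
  /-- The height component of the inverse. -/
  height : EuclideanSpace ℝ (Fin (n + 2)) → ℝ
  /-- The lower end of the parameter interval. -/
  bot : ℝ
  /-- The upper end of the parameter interval. -/
  top : ℝ
  /-- The image of `N × (bot, top)`. -/
  region : Set (EuclideanSpace ℝ (Fin (n + 2)))
  bot_neg : bot < 0
  one_lt_top : 1 < top
  isOpen_region : IsOpen region
  mem_region : ∀ x, ∀ t ∈ Ioo bot top, toFun x t ∈ region
  proj_apply : ∀ x, ∀ t ∈ Ioo bot top, proj (toFun x t) = x
  height_apply : ∀ x, ∀ t ∈ Ioo bot top, height (toFun x t) = t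
  height_mem : ∀ z ∈ region, height z ∈ Ioo bot top
  apply_proj_height : ∀ z ∈ region, toFun (proj z) (height z) = z
  contMDiffOn_toFun : ContMDiffOn ((𝓡 (n + 1)).prod 𝓘(ℝ, ℝ)) (𝓡 (n + 2)) ∞ (uncurry toFun)
    (univ ×ˢ Ioo bot top)
  contMDiffOn_proj : ContMDiffOn (𝓡 (n + 2)) (𝓡 (n + 1)) ∞ proj region
  contMDiffOn_height : ContMDiffOn (𝓡 (n + 2)) 𝓘(ℝ, ℝ) ∞ height region

namespace EuclideanCollarData

variable (D : EuclideanCollarData n N)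

/-! ### The closed collar map and its inverse -/

/-- The closed collar map `N × [0, 1] → ℝⁿ⁺²`, `(x, t) ↦ toFun x t`. [folklore] -/
def collarMap (p : N × Set.Icc (0 : ℝ) 1) : EuclideanSpace ℝ (Fin (n + 2)) := D.toFun p.1 p.2

/-- Formula for the closed collar map. [folklore] -/
theorem collarMap_apply (p : N × Set.Icc (0 : ℝ) 1) : D.collarMap p = D.toFun p.1 p.2 := rfl

/-- A parameter `t ∈ [0, 1]` lies in `(bot, top)`. [folklore] -/
theorem coe_mem_Ioo (t : Set.Icc (0 : ℝ) 1) : (t : ℝ) ∈ Ioo D.bot D.top :=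
  ⟨D.bot_neg.trans_le t.2.1, t.2.2.trans_lt D.one_lt_top⟩

/-- The closed collar map takes values in `region`. [folklore] -/
theorem collarMap_mem_region (p : N × Set.Icc (0 : ℝ) 1) : D.collarMap p ∈ D.region :=
  D.mem_region p.1 p.2 (D.coe_mem_Ioo p.2)

/-- `proj` inverts the closed collar map in the first variable. [folklore] -/
theorem proj_collarMap (p : N × Set.Icc (0 : ℝ) 1) : D.proj (D.collarMap p) = p.1 :=
  D.proj_apply p.1 p.2 (D.coe_mem_Ioo p.2)

/-- `height` inverts the closed collar map in the second variable. [folklore] -/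
theorem height_collarMap (p : N × Set.Icc (0 : ℝ) 1) : D.height (D.collarMap p) = p.2 :=
  D.height_apply p.1 p.2 (D.coe_mem_Ioo p.2)

/-- The collar map is continuous on `N × (bot, top)`. [folklore] -/
theorem continuousOn_toFun : ContinuousOn (uncurry D.toFun) (univ ×ˢ Ioo D.bot D.top) :=
  D.contMDiffOn_toFun.continuousOn

/-- The closed collar map is continuous. [folklore] -/
theorem continuous_collarMap : Continuous D.collarMap :=
  D.continuousOn_toFun.comp_continuous (f := fun p : N × Set.Icc (0 : ℝ) 1 => (p.1, (p.2 : ℝ)))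
    (by fun_prop) fun p => ⟨mem_univ _, D.coe_mem_Ioo p.2⟩

/-- The inverse of the closed collar map (meaningful on `region ∩ {0 ≤ height ≤ 1}`). [folklore] -/
def collarInv (z : EuclideanSpace ℝ (Fin (n + 2))) : N × Set.Icc (0 : ℝ) 1 :=
  (D.proj z, Set.projIcc 0 1 zero_le_one (D.height z))

/-- `collarInv` is a left inverse of the closed collar map. [folklore] -/
theorem collarInv_collarMap (p : N × Set.Icc (0 : ℝ) 1) : D.collarInv (D.collarMap p) = p := by
  obtain ⟨x, t⟩ := p
  simp only [collarInv, proj_collarMap, height_collarMap, Set.projIcc_val]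

/-- The closed collar map is injective. [folklore] -/
theorem injective_collarMap : Injective D.collarMap :=
  LeftInverse.injective fun p => D.collarInv_collarMap p

/-- `collarInv` is continuous on `region`. [folklore] -/
theorem continuousOn_collarInv : ContinuousOn D.collarInv D.region :=
  D.contMDiffOn_proj.continuousOn.prodMk
    (continuous_projIcc.comp_continuousOn D.contMDiffOn_height.continuousOn)

/-- The closed collar map is a topological embedding (its inverse `(proj, height)` is continuous
on the open `region`). [folklore] -/
theorem isEmbedding_collarMap : Topology.IsEmbedding D.collarMap := by
  let j : N × Set.Icc (0 : ℝ) 1 → D.region := fun p => ⟨D.collarMap p, D.collarMap_mem_region p⟩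
  have hj : Continuous j := D.continuous_collarMap.subtype_mk _
  have hg : Continuous fun z : D.region => D.collarInv z :=
    D.continuousOn_collarInv.comp_continuous continuous_subtype_val fun z => z.2
  have hleft : LeftInverse (fun z : D.region => D.collarInv z) j := fun p => D.collarInv_collarMap p
  have hemb : Topology.IsEmbedding j := Topology.IsEmbedding.of_leftInverse hleft hg hj
  exact Topology.IsEmbedding.subtypeVal.comp hemb

/-! ### The two charts of `ℝⁿ⁺²` adapted to the collar -/

section Charts

variable (φ₀ : OpenPartialHomeomorph N (EuclideanSpace ℝ (Fin (n + 1))))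

/-- The reparametrisation of the height used by the chart: `height` itself (`ε = false`, for the
bottom chart) or `1 - height` (`ε = true`, for the top chart); an involution. [folklore] -/
def flipHeight (ε : Bool) (s : ℝ) : ℝ := cond ε (1 - s) s

/-- `flipHeight` is an involution. [folklore] -/
@[simp] theorem flipHeight_flipHeight (ε : Bool) (s : ℝ) : flipHeight ε (flipHeight ε s) = s := by
  cases ε <;> simp [flipHeight]

/-- `flipHeight` is smooth. [folklore] -/
theorem contDiff_flipHeight (ε : Bool) : ContDiff ℝ ∞ (flipHeight ε) := by
  cases ε
  · exact contDiff_id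
  · exact contDiff_const.sub contDiff_id

/-- `flipHeight` is continuous. [folklore] -/
theorem continuous_flipHeight (ε : Bool) : Continuous (flipHeight ε) := (contDiff_flipHeight ε).continuous

/-- **The chart of `ℝⁿ⁺²` adapted to the collar**: on `region ∩ proj ⁻¹' φ₀.source` the map
`z ↦ (flipHeight ε (height z), φ₀ (proj z))` with inverse
`v ↦ toFun (φ₀.symm (tail v)) (flipHeight ε (v 0))`; `φ₀` a chart of `N`. [folklore] -/
def adaptedChart (ε : Bool) :
    OpenPartialHomeomorph (EuclideanSpace ℝ (Fin (n + 2))) (EuclideanSpace ℝ (Fin (n + 2))) where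
  toFun z := BoundaryManifold.consCLE (n + 1) (φ₀ (D.proj z), flipHeight ε (D.height z))
  invFun v := D.toFun (φ₀.symm (BoundaryManifold.tail (n + 1) v)) (flipHeight ε (v 0))
  source := D.region ∩ D.proj ⁻¹' φ₀.source
  target := {v | BoundaryManifold.tail (n + 1) v ∈ φ₀.target ∧ flipHeight ε (v 0) ∈ Ioo D.bot D.top}
  map_source' := by
    rintro z ⟨hz, hzs⟩
    refine ⟨?_, ?_⟩
    · show BoundaryManifold.tail (n + 1) (BoundaryManifold.consCLE (n + 1) _) ∈ φ₀.target
      rw [BoundaryManifold.tail_consCLE]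
      exact φ₀.map_source hzs
    · show flipHeight ε (BoundaryManifold.consCLE (n + 1)
        (φ₀ (D.proj z), flipHeight ε (D.height z)) 0) ∈ Ioo D.bot D.top
      rw [BoundaryManifold.consCLE_apply_zero, flipHeight_flipHeight]
      exact D.height_mem z hz
  map_target' := by
    rintro v ⟨hv, hvt⟩
    refine ⟨D.mem_region _ _ hvt, ?_⟩
    show D.proj (D.toFun _ _) ∈ φ₀.source
    rw [D.proj_apply _ _ hvt]
    exact φ₀.map_target hv
  left_inv' := by
    rintro z ⟨hz, hzs⟩
    simp only [BoundaryManifold.tail_consCLE, BoundaryManifold.consCLE_apply_zero,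
      flipHeight_flipHeight, φ₀.left_inv hzs]
    exact D.apply_proj_height z hz
  right_inv' := by
    rintro v ⟨hv, hvt⟩
    simp only [D.proj_apply _ _ hvt, D.height_apply _ _ hvt, φ₀.right_inv hv,
      flipHeight_flipHeight]
    exact BoundaryManifold.consCLE_tail (n + 1) v
  open_source := D.contMDiffOn_proj.continuousOn.isOpen_inter_preimage D.isOpen_region
    φ₀.open_source
  open_target :=
    (φ₀.open_target.preimage (BoundaryManifold.continuous_tail (n + 1))).inter
      (isOpen_Ioo.preimage ((continuous_flipHeight ε).comp (PiLp.continuous_apply 2 _ 0)))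
  continuousOn_toFun := by
    refine (BoundaryManifold.consCLE (n + 1)).continuous.comp_continuousOn ?_
    refine ContinuousOn.prodMk ?_ ((continuous_flipHeight ε).comp_continuousOn
      (D.contMDiffOn_height.continuousOn.mono inter_subset_left))
    exact φ₀.continuousOn.comp (D.contMDiffOn_proj.continuousOn.mono inter_subset_left)
      fun z hz => hz.2
  continuousOn_invFun := by
    have hA : Continuous fun v : EuclideanSpace ℝ (Fin (n + 2)) =>
        (BoundaryManifold.tail (n + 1) v, flipHeight ε (v 0)) :=
      (BoundaryManifold.continuous_tail (n + 1)).prodMk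
        ((continuous_flipHeight ε).comp (PiLp.continuous_apply 2 _ 0))
    have hB : ContinuousOn (fun q : EuclideanSpace ℝ (Fin (n + 1)) × ℝ => (φ₀.symm q.1, q.2))
        (φ₀.target ×ˢ univ) :=
      (φ₀.continuousOn_symm.comp continuousOn_fst fun q hq => hq.1).prodMk continuousOn_snd
    refine D.continuousOn_toFun.comp (hB.comp hA.continuousOn ?_) ?_
    · rintro v ⟨hv, -⟩
      exact ⟨hv, mem_univ _⟩
    · rintro v ⟨-, hvt⟩
      exact ⟨mem_univ _, hvt⟩

/-- The source of the adapted chart (definitional). [folklore] -/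
theorem adaptedChart_source (ε : Bool) :
    (D.adaptedChart φ₀ ε).source = D.region ∩ D.proj ⁻¹' φ₀.source := rfl

/-- The adapted chart, evaluated (definitional). [folklore] -/
theorem adaptedChart_apply (ε : Bool) (z : EuclideanSpace ℝ (Fin (n + 2))) :
    D.adaptedChart φ₀ ε z =
      BoundaryManifold.consCLE (n + 1) (φ₀ (D.proj z), flipHeight ε (D.height z)) := rfl

/-- The inverse of the adapted chart (definitional). [folklore] -/
theorem adaptedChart_symm_apply (ε : Bool) (v : EuclideanSpace ℝ (Fin (n + 2))) :
    (D.adaptedChart φ₀ ε).symm v =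
      D.toFun (φ₀.symm (BoundaryManifold.tail (n + 1) v)) (flipHeight ε (v 0)) := rfl

/-- The inverse of the adapted chart is smooth (it is
`v ↦ toFun (φ₀.symm (tail v)) (flipHeight ε (v 0))`). [folklore] -/
theorem contMDiffOn_adaptedChart_symm (ε : Bool)
    (hφ₀ : φ₀ ∈ IsManifold.maximalAtlas (𝓡 (n + 1)) ∞ N) :
    ContMDiffOn (𝓡 (n + 2)) (𝓡 (n + 2)) ∞ (D.adaptedChart φ₀ ε).symm (D.adaptedChart φ₀ ε).target := by
  have h1 : ContMDiffOn (𝓡 (n + 2)) (𝓡 (n + 1)) ∞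
      (fun v : EuclideanSpace ℝ (Fin (n + 2)) => φ₀.symm (BoundaryManifold.tail (n + 1) v))
      (D.adaptedChart φ₀ ε).target := by
    have htail : ContMDiff (𝓡 (n + 2)) 𝓘(ℝ, EuclideanSpace ℝ (Fin (n + 1))) ∞
        fun v : EuclideanSpace ℝ (Fin (n + 2)) => BoundaryManifold.tail (n + 1) v :=
      (BoundaryManifold.contDiff_tail (n + 1)).contMDiff
    exact (contMDiffOn_symm_of_mem_maximalAtlas hφ₀).comp htail.contMDiffOn fun v hv => hv.1
  have h2 : ContMDiff (𝓡 (n + 2)) 𝓘(ℝ, ℝ) ∞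
      fun v : EuclideanSpace ℝ (Fin (n + 2)) => flipHeight ε (v 0) :=
    ((contDiff_flipHeight ε).comp (EuclideanSpace.proj (0 : Fin (n + 2))).contDiff).contMDiff
  refine (D.contMDiffOn_toFun.comp (h1.prodMk h2.contMDiffOn) ?_).congr fun v hv => rfl
  rintro v ⟨-, hvt⟩
  exact ⟨mem_univ _, hvt⟩

/-- The adapted chart is smooth (it is `(flipHeight ε ∘ height, φ₀ ∘ proj)` read in `ℝⁿ⁺²`).
[folklore] -/
theorem contMDiffOn_adaptedChart (ε : Bool)
    (hφ₀ : φ₀ ∈ IsManifold.maximalAtlas (𝓡 (n + 1)) ∞ N) :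
    ContMDiffOn (𝓡 (n + 2)) (𝓡 (n + 2)) ∞ (D.adaptedChart φ₀ ε) (D.adaptedChart φ₀ ε).source := by
  have hG : ContMDiffOn (𝓡 (n + 2)) 𝓘(ℝ, EuclideanSpace ℝ (Fin (n + 2))) ∞
      (fun z => BoundaryManifold.consCLE (n + 1) (φ₀ (D.proj z), flipHeight ε (D.height z)))
      (D.adaptedChart φ₀ ε).source := by
    refine (BoundaryManifold.consCLE (n + 1)).contDiff.contMDiff.comp_contMDiffOn ?_
    refine ContMDiffOn.prodMk_space ?_ ?_
    · exact (contMDiffOn_of_mem_maximalAtlas hφ₀).comp (D.contMDiffOn_proj.mono inter_subset_left)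
        fun z hz => hz.2
    · exact (contDiff_flipHeight ε).contMDiff.comp_contMDiffOn (D.contMDiffOn_height.mono inter_subset_left)
  exact hG

/-- The adapted chart belongs to the maximal `C^∞` atlas of `ℝⁿ⁺²`. [folklore] -/
theorem adaptedChart_mem_maximalAtlas (ε : Bool)
    (hφ₀ : φ₀ ∈ IsManifold.maximalAtlas (𝓡 (n + 1)) ∞ N) :
    D.adaptedChart φ₀ ε ∈ IsManifold.maximalAtlas (𝓡 (n + 2)) ∞ (EuclideanSpace ℝ (Fin (n + 2))) :=
  (D.adaptedChart φ₀ ε).mem_maximalAtlas_of_contMDiffOn (D.contMDiffOn_adaptedChart φ₀ ε hφ₀)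
    (D.contMDiffOn_adaptedChart_symm φ₀ ε hφ₀)

end Charts

/-! ### The closed collar is an immersion -/

section Immersion

variable [IsManifold (𝓡 (n + 1)) ∞ N]

omit [IsManifold (𝓡 (n + 1)) ∞ N] in
/-- In the product chart `φ₀ × (left chart of [0, 1])` and the bottom chart
`adaptedChart φ₀ false` the collar map reads `(w, s) ↦ (s 0, w)`. [folklore] -/
theorem adaptedChart_false_extend_collarMap
    (φ₀ : OpenPartialHomeomorph N (EuclideanSpace ℝ (Fin (n + 1)))) (p : N × Set.Icc (0 : ℝ) 1) :
    (D.adaptedChart φ₀ false).extend (𝓡 (n + 2)) (D.collarMap p) =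
      BoundaryData.collarConsL n ((φ₀.prod (IccLeftChart (0 : ℝ) 1)).extend ((𝓡 (n + 1)).prod (𝓡∂ 1)) p) := by
  rw [OpenPartialHomeomorph.extend_coe, comp_apply]
  show (𝓡 (n + 2)) (D.adaptedChart φ₀ false (D.collarMap p)) = _
  rw [adaptedChart_apply, D.proj_collarMap, D.height_collarMap, BoundaryData.collarConsL_apply]
  show BoundaryManifold.consCLE (n + 1) (φ₀ p.1, (p.2 : ℝ)) = _
  congr 2
  show (p.2 : ℝ) = (p.2 : ℝ) - 0
  rw [sub_zero]

omit [IsManifold (𝓡 (n + 1)) ∞ N] in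
/-- In the product chart `φ₀ × (right chart of [0, 1])` and the top chart
`adaptedChart φ₀ true` the collar map reads `(w, s) ↦ (s 0, w)`. [folklore] -/
theorem adaptedChart_true_extend_collarMap
    (φ₀ : OpenPartialHomeomorph N (EuclideanSpace ℝ (Fin (n + 1)))) (p : N × Set.Icc (0 : ℝ) 1) :
    (D.adaptedChart φ₀ true).extend (𝓡 (n + 2)) (D.collarMap p) =
      BoundaryData.collarConsL n ((φ₀.prod (IccRightChart (0 : ℝ) 1)).extend ((𝓡 (n + 1)).prod (𝓡∂ 1)) p) := by
  rw [OpenPartialHomeomorph.extend_coe, comp_apply]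
  show (𝓡 (n + 2)) (D.adaptedChart φ₀ true (D.collarMap p)) = _
  rw [adaptedChart_apply, D.proj_collarMap, D.height_collarMap, BoundaryData.collarConsL_apply]
  show BoundaryManifold.consCLE (n + 1) (φ₀ p.1, 1 - (p.2 : ℝ)) = _
  rfl

/-- The closed collar map is an immersion at every point below the top. [folklore] -/
theorem isImmersionAt_collarMap_of_lt {p : N × Set.Icc (0 : ℝ) 1} (hp : (p.2 : ℝ) < 1) :
    Manifold.IsImmersionAtOfComplement PUnit ((𝓡 (n + 1)).prod (𝓡∂ 1)) (𝓡 (n + 2)) ∞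
      D.collarMap p := by
  set φ₀ := chartAt (EuclideanSpace ℝ (Fin (n + 1))) p.1 with hφ₀def
  have hφ₀ : φ₀ ∈ IsManifold.maximalAtlas (𝓡 (n + 1)) ∞ N := IsManifold.chart_mem_maximalAtlas p.1
  set e := (φ₀.prod (IccLeftChart (0 : ℝ) 1)).extend ((𝓡 (n + 1)).prod (𝓡∂ 1)) with hedef
  refine Manifold.IsImmersionAtOfComplement.mk_of_continuousAt
    D.continuous_collarMap.continuousAt
    ((ContinuousLinearEquiv.prodUnique ℝ _ PUnit).trans (BoundaryData.collarConsL n))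
    (φ₀.prod (IccLeftChart (0 : ℝ) 1)) (D.adaptedChart φ₀ false) ?_ ?_
    (IsManifold.mem_maximalAtlas_prod hφ₀ BoundaryData.OpenCollarData.iccLeftChart_mem_maximalAtlas)
    (D.adaptedChart_mem_maximalAtlas φ₀ false hφ₀) ?_
  · rw [OpenPartialHomeomorph.prod_source]
    exact ⟨mem_chart_source _ p.1, hp⟩
  · rw [adaptedChart_source]
    exact ⟨D.collarMap_mem_region p, by
      rw [mem_preimage, D.proj_collarMap]; exact mem_chart_source _ p.1⟩
  · intro q hq
    have key := D.adaptedChart_false_extend_collarMap φ₀ (e.symm q)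
    rw [e.right_inv hq] at key
    exact key

/-- The closed collar map is an immersion at every point above the bottom. [folklore] -/
theorem isImmersionAt_collarMap_of_pos {p : N × Set.Icc (0 : ℝ) 1} (hp : 0 < (p.2 : ℝ)) :
    Manifold.IsImmersionAtOfComplement PUnit ((𝓡 (n + 1)).prod (𝓡∂ 1)) (𝓡 (n + 2)) ∞
      D.collarMap p := by
  set φ₀ := chartAt (EuclideanSpace ℝ (Fin (n + 1))) p.1 with hφ₀def
  have hφ₀ : φ₀ ∈ IsManifold.maximalAtlas (𝓡 (n + 1)) ∞ N := IsManifold.chart_mem_maximalAtlas p.1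
  set e := (φ₀.prod (IccRightChart (0 : ℝ) 1)).extend ((𝓡 (n + 1)).prod (𝓡∂ 1)) with hedef
  refine Manifold.IsImmersionAtOfComplement.mk_of_continuousAt
    D.continuous_collarMap.continuousAt
    ((ContinuousLinearEquiv.prodUnique ℝ _ PUnit).trans (BoundaryData.collarConsL n))
    (φ₀.prod (IccRightChart (0 : ℝ) 1)) (D.adaptedChart φ₀ true) ?_ ?_
    (IsManifold.mem_maximalAtlas_prod hφ₀ BoundaryData.OpenCollarData.iccRightChart_mem_maximalAtlas)
    (D.adaptedChart_mem_maximalAtlas φ₀ true hφ₀) ?_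
  · rw [OpenPartialHomeomorph.prod_source]
    exact ⟨mem_chart_source _ p.1, hp⟩
  · rw [adaptedChart_source]
    exact ⟨D.collarMap_mem_region p, by
      rw [mem_preimage, D.proj_collarMap]; exact mem_chart_source _ p.1⟩
  · intro q hq
    have key := D.adaptedChart_true_extend_collarMap φ₀ (e.symm q)
    rw [e.right_inv hq] at key
    exact key

/-- The closed collar map is an immersion. [folklore] -/
theorem isImmersion_collarMap :
    Manifold.IsImmersion ((𝓡 (n + 1)).prod (𝓡∂ 1)) (𝓡 (n + 2)) ∞ D.collarMap := by
  refine Manifold.IsImmersionOfComplement.isImmersion (F := PUnit.{1}) fun p => ?_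
  by_cases hp : (p.2 : ℝ) < 1
  · exact D.isImmersionAt_collarMap_of_lt hp
  · exact D.isImmersionAt_collarMap_of_pos (zero_lt_one.trans_le (not_lt.1 hp))

/-- **The closed collar map is a smooth embedding** `N × [0, 1] → ℝⁿ⁺²` for the product model
with corners. [folklore] -/
theorem isSmoothEmbedding_collarMap :
    Manifold.IsSmoothEmbedding ((𝓡 (n + 1)).prod (𝓡∂ 1)) (𝓡 (n + 2)) ∞ D.collarMap :=
  ⟨D.isImmersion_collarMap, D.isEmbedding_collarMap⟩

end Immersion

end EuclideanCollarData

end Literature.Topology.FourManifolds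

end
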